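import Summits.QuantumFields.YangMills.Theorems.SwapVirialDeficitBlowUpGnomonicRotCovariance
import HarnessLib

/-!
# Route `SwapVirialDeficit` (YangMills): HOW FAR A UNIT CONJUGATION TILTS A STANDARD HUB — `‖u·a·ū − a‖ = |a.imI|·|rot3 u e₀ − e₀| ≤ |a.imI|·|τ⃗|`
# (cell ym-idea-1, skeleton ➎ v14, `stub_core_tip`; brick (F1b) of w3 g68's (hCore) design memo `w3-g68-memo-hCore-24197.md` §2(iii)/§4;
# LEAD seat ym-line-sfw-p2 g100, free-hands support of ⟨stmt-QuantumFields-24197⟩ `SwapVirialDeficit.SwapGluedStiffness`)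

After ✓`gnoDeficit_gnoRot_eq_cart` (rotating all gnomonic letters at a standard hub `a` by `gnoRot w` = evaluating the Cartesian-hub deficit at the
TILTED hub `w·a·w̄` at fixed letters) and ✓`exists_gnoRot_gnoBase_eq_jointTilt` (the soft letter line with joint tilt `τ⃗` is `gnoRot u_τ` of a rescaled
flat base, `rot3 u_τ e₀ = (1, τ⃗)/√(1+|τ⃗|²)`), the assembly of the tip core needs the SIZE of the hub tilt.  For a hub in the `(1, i)`-plane,
`a.imJ = a.imK = 0` (e.g. `angUnit θ`, `hubAt δ σ`), and a unit `u`: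
* §1 `unit_conj_sub_eq_smul` — `u·a·ū − a = a.imI·(u·i·ū − i)` (real scalars are central);
* §2 `norm_unit_conj_sub_eq_norm_star_conj_sub` — `‖u·q·ū − q‖ = ‖ū·q·u − q‖` (conjugation is an isometry, cf. ✓`NearlyCommutingCeiling.norm_conj_of_norm_eq_one`), and
  `star_conj_imQuat_sub` — `ū·i·u − i = gnomonicQuat (rot3 u e₀) − gnomonicQuat e₀`, whose norm is `√(normSq3 (rot3 u e₀ − e₀))` (`norm_gnomonicQuat_sub`);
* §3 ★ `norm_unit_conj_sub_eq` — `‖u·a·ū − a‖ = |a.imI|·√(normSq3 (rot3 u e₀ − e₀))`; specialisations `norm_unit_conj_angUnit_sub` (`a.imI = sin θ`) and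
  `norm_unit_conj_hubAt_sub` (`a.imI = √σ`); crude `norm_unit_conj_sub_le_two_mul` (`≤ 2|a.imI|`);
* §4 ★ `normSq3_rot3_e0_sub_of_jointTilt` — if `rot3 u e₀ = λ⁻¹·(1, τ₀, τ₁)`, `λ = √(1 + τ₀² + τ₁²)`, then `normSq3 (rot3 u e₀ − e₀) = 2·(1 − λ⁻¹) ≤ τ₀² + τ₁²`
  (`two_mul_one_sub_inv_sqrt_le`); hence ★ `norm_unit_conj_angUnit_sub_le_jointTilt` ∕ `norm_unit_conj_hubAt_sub_le_jointTilt`: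
  `‖u_τ·A(θ)·ū_τ − A(θ)‖ ≤ |sin θ|·|τ⃗|` and `‖u_τ·hubAt δ σ·ū_τ − hubAt δ σ‖ ≤ √σ·|τ⃗|` — the tilt of the tip hub along the soft letter line is
  `sin θ_t·|τ⃗|` RELATIVE to the hub size, uniformly in the base point.

HONEST LABEL: quaternion algebra only; `stub_core_tip`, ⟨24197⟩ ∕ ⟨24194⟩ OPEN; own crux ⟨22884⟩ `LargeFieldMassRefinementTail` OPEN (blocked-on ⟨19935⟩);
the Yang–Mills mass gap is NOT proved; no summit is proved by a line.  THEOREMS ONLY (0 `def`, 0 `sorry`, no instance, no notation), standard axioms.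
`--supports stmt-QuantumFields-24197`.  References: [folklore].
-/

set_option autoImplicit false

noncomputable section

open Quaternion Set
open scoped Quaternion
open Literature.MathematicalPhysics.QuantumLattice
open Literature.MathematicalPhysics.QuantumFieldTheory hiding SU2

namespace Summit.QuantumFields.YangMills.Theorems.SwapVirialDeficit.BlowUpRing

open Summit.QuantumFields.YangMills.Theorems.SwapVirialDeficit.Gnomonic (normSq3)

/-! ## §1 Conjugating a hub of the `(1, i)`-plane -/

/-- The unit `i` as a gnomonic quaternion: `gnomonicQuat e₀ − 1 = ⟨0, 1, 0, 0⟩`. [folklore] -/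
theorem gnomonicQuat_e0_sub_one : gnomonicQuat ![1, 0, 0] - 1 = (⟨0, 1, 0, 0⟩ : ℍ) := by
  ext <;> simp [gnomonicQuat]

/-- `u·c·ū = c` for a unit `u` and a real scalar `c`. [folklore] -/
theorem unit_conj_coe {u : ℍ} (hu : ‖u‖ = 1) (c : ℝ) : u * (c : ℍ) * star u = (c : ℍ) := by
  have h := conj_coe_of_unit (u := star u) (by rw [Quaternion.norm_star]; exact hu) c
  rwa [star_star] at h

/-- `a − a.imI·(gnomonicQuat e₀ − 1) = a.re` for a hub of the `(1, i)`-plane. [folklore] -/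
theorem sub_imI_smul_eq_coe {a : ℍ} (hJ : a.imJ = 0) (hK : a.imK = 0) : a - a.imI • (gnomonicQuat ![1, 0, 0] - 1) = (a.re : ℍ) := by
  rw [gnomonicQuat_e0_sub_one]
  ext <;> simp [hJ, hK]

/-- §1 `u·a·ū − a = a.imI·(u·i·ū − i)` for a unit `u` and a hub `a` of the `(1, i)`-plane (`a.imJ = a.imK = 0`; real scalars are central). [folklore] -/
theorem unit_conj_sub_eq_smul {u : ℍ} (hu : ‖u‖ = 1) {a : ℍ} (hJ : a.imJ = 0) (hK : a.imK = 0) :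
    u * a * star u - a = a.imI • (u * (gnomonicQuat ![1, 0, 0] - 1) * star u - (gnomonicQuat ![1, 0, 0] - 1)) := by
  have split : ∀ q : ℍ, u * a * star u - a = (u * (a - a.imI • q) * star u - (a - a.imI • q)) + a.imI • (u * q * star u - q) := by
    intro q
    rw [mul_sub, sub_mul, mul_smul_comm, smul_mul_assoc, smul_sub]
    abel
  rw [split (gnomonicQuat ![1, 0, 0] - 1), sub_imI_smul_eq_coe hJ hK, unit_conj_coe hu, sub_self, zero_add]

/-! ## §2 Conjugation is an isometry; the conjugated `i` is the rotated `e₀` -/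

/-- `‖u·q·ū − q‖ = ‖ū·q·u − q‖` for a unit `u`: `ū·(u·q·ū − q)·u = q − ū·q·u`. [folklore] -/
theorem norm_unit_conj_sub_eq_norm_star_conj_sub {u : ℍ} (hu : ‖u‖ = 1) (q : ℍ) :
    ‖u * q * star u - q‖ = ‖star u * q * u - q‖ := by
  obtain ⟨hsu, _⟩ := star_mul_self_of_unit hu
  have key : star u * (u * q * star u - q) * u = q - star u * q * u := by
    have e1 : star u * (u * q * star u) * u = q := by
      calc star u * (u * q * star u) * u = (star u * u) * q * (star u * u) := by simp only [mul_assoc]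
        _ = q := by rw [hsu, one_mul, mul_one]
    rw [mul_sub, sub_mul, e1]
  have hiso : ‖star u * (u * q * star u - q) * u‖ = ‖u * q * star u - q‖ := by
    rw [norm_mul, norm_mul, Quaternion.norm_star, hu, one_mul, mul_one]
  rw [← hiso, key, ← norm_neg, neg_sub]

/-- `ū·i·u − i = gnomonicQuat (rot3 u e₀) − gnomonicQuat e₀` for a unit `u` (✓`gnomonicQuat_rot3`, `ū·1·u = 1`). [folklore] -/
theorem star_conj_imQuat_sub {u : ℍ} (hu : ‖u‖ = 1) :
    star u * (gnomonicQuat ![1, 0, 0] - 1) * u - (gnomonicQuat ![1, 0, 0] - 1) =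
      gnomonicQuat (rot3 u ![1, 0, 0]) - gnomonicQuat ![1, 0, 0] := by
  have h1 : star u * (1 : ℍ) * u = 1 := by
    have h := conj_coe_of_unit hu 1
    push_cast at h
    exact h
  rw [mul_sub, sub_mul, h1, gnomonicQuat_rot3 hu]
  abel

/-- `‖gnomonicQuat v − gnomonicQuat w‖ = √(normSq3 (v − w))` (the difference is purely imaginary with vector part `v − w`). [folklore] -/
theorem norm_gnomonicQuat_sub (v w : Fin 3 → ℝ) : ‖gnomonicQuat v - gnomonicQuat w‖ = Real.sqrt (normSq3 (v - w)) := by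
  have hsq : ‖gnomonicQuat v - gnomonicQuat w‖ ^ 2 = normSq3 (v - w) := by
    rw [sq, ← Quaternion.normSq_eq_norm_mul_self, Quaternion.normSq_def']
    unfold normSq3
    rw [Fin.sum_univ_three]
    simp [gnomonicQuat]
  rw [← hsq, Real.sqrt_sq (norm_nonneg _)]

/-! ## §3 The size of the tilt -/

/-- ★ §3 `‖u·a·ū − a‖ = |a.imI|·√(normSq3 (rot3 u e₀ − e₀))` for a unit `u` and a hub `a` of the `(1, i)`-plane. [folklore] -/
theorem norm_unit_conj_sub_eq {u : ℍ} (hu : ‖u‖ = 1) {a : ℍ} (hJ : a.imJ = 0) (hK : a.imK = 0) :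
    ‖u * a * star u - a‖ = |a.imI| * Real.sqrt (normSq3 (rot3 u ![1, 0, 0] - ![1, 0, 0])) := by
  rw [unit_conj_sub_eq_smul hu hJ hK, norm_smul, Real.norm_eq_abs, norm_unit_conj_sub_eq_norm_star_conj_sub hu, star_conj_imQuat_sub hu,
    norm_gnomonicQuat_sub]

/-- `‖u·A(θ)·ū − A(θ)‖ = |sin θ|·√(normSq3 (rot3 u e₀ − e₀))`. [folklore] -/
theorem norm_unit_conj_angUnit_sub {u : ℍ} (hu : ‖u‖ = 1) (θ : ℝ) :
    ‖u * angUnit θ * star u - angUnit θ‖ = |Real.sin θ| * Real.sqrt (normSq3 (rot3 u ![1, 0, 0] - ![1, 0, 0])) :=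
  norm_unit_conj_sub_eq hu (angUnit_imJ θ) (angUnit_imK θ)

/-- `‖u·hubAt δ σ·ū − hubAt δ σ‖ = √σ·√(normSq3 (rot3 u e₀ − e₀))` (`hubAt δ σ = ⟨δ, √σ, 0, 0⟩`). [folklore] -/
theorem norm_unit_conj_hubAt_sub {u : ℍ} (hu : ‖u‖ = 1) (δ σ : ℝ) :
    ‖u * hubAt δ σ * star u - hubAt δ σ‖ = Real.sqrt σ * Real.sqrt (normSq3 (rot3 u ![1, 0, 0] - ![1, 0, 0])) := by
  rw [norm_unit_conj_sub_eq hu (show (hubAt δ σ).imJ = 0 from rfl) (show (hubAt δ σ).imK = 0 from rfl),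
    show (hubAt δ σ).imI = Real.sqrt σ from rfl, abs_of_nonneg (Real.sqrt_nonneg σ)]

/-- A crude bound valid for every unit `u`: `‖u·a·ū − a‖ ≤ 2|a.imI|` for a hub `a` of the `(1, i)`-plane. [folklore] -/
theorem norm_unit_conj_sub_le_two_mul {u : ℍ} (hu : ‖u‖ = 1) {a : ℍ} (hJ : a.imJ = 0) (hK : a.imK = 0) :
    ‖u * a * star u - a‖ ≤ 2 * |a.imI| := by
  have h1 : ‖u * a * star u - a‖ ≤ |a.imI| * ‖u * (gnomonicQuat ![1, 0, 0] - 1) * star u‖ + |a.imI| * ‖gnomonicQuat ![1, 0, 0] - (1 : ℍ)‖ := by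
    rw [unit_conj_sub_eq_smul hu hJ hK, norm_smul, Real.norm_eq_abs, ← mul_add]
    exact mul_le_mul_of_nonneg_left (norm_sub_le _ _) (abs_nonneg _)
  have hi : ‖gnomonicQuat ![1, 0, 0] - (1 : ℍ)‖ = 1 := by
    have h : ‖gnomonicQuat ![1, 0, 0] - (1 : ℍ)‖ ^ 2 = 1 := by
      rw [sq, ← Quaternion.normSq_eq_norm_mul_self, Quaternion.normSq_def']
      simp [gnomonicQuat]
    nlinarith [norm_nonneg (gnomonicQuat ![1, 0, 0] - (1 : ℍ))]
  have hc : ‖u * (gnomonicQuat ![1, 0, 0] - 1) * star u‖ = 1 := by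
    rw [norm_mul, norm_mul, Quaternion.norm_star, hu, hi, one_mul, one_mul]
  rw [hc, hi] at h1
  linarith

/-! ## §4 The joint tilt -/

/-- `2·(1 − (√(1 + t))⁻¹) ≤ t` for `0 ≤ t` (i.e. `1 − t/2 ≤ (1+t)^{−1/2}`). [folklore] -/
theorem two_mul_one_sub_inv_sqrt_le {t : ℝ} (ht : 0 ≤ t) : 2 * (1 - (Real.sqrt (1 + t))⁻¹) ≤ t := by
  set lam := Real.sqrt (1 + t) with hlam
  have hlam1 : 1 ≤ lam := by rw [hlam]; exact Real.one_le_sqrt.2 (by linarith)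
  have hlam0 : 0 < lam := by linarith
  have hlam2 : lam ^ 2 = 1 + t := Real.sq_sqrt (by linarith)
  -- `2(1 − λ⁻¹) = 2(λ − 1)/λ ≤ (λ − 1)(λ + 1) = λ² − 1 = t` since `2/λ ≤ λ + 1` (`λ ≥ 1`).
  have key : 2 * (1 - lam⁻¹) * lam ≤ t * lam := by
    have e : 2 * (1 - lam⁻¹) * lam = 2 * (lam - 1) := by field_simp
    rw [e]; nlinarith [hlam1, hlam2]
  exact le_of_mul_le_mul_right key hlam0

/-- ★ §4 If `rot3 u e₀ = λ⁻¹·(1, τ₀, τ₁)` with `λ = √(1 + τ₀² + τ₁²)` (✓`exists_gnoRot_gnoBase_eq_jointTilt`), then `normSq3 (rot3 u e₀ − e₀) = 2·(1 − λ⁻¹)`.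
[folklore] -/
theorem normSq3_rot3_e0_sub_of_jointTilt {u : ℍ} {τ : Fin 2 → ℝ}
    (hrot : rot3 u ![1, 0, 0] = (Real.sqrt (1 + (τ 0 ^ 2 + τ 1 ^ 2)))⁻¹ • (![1, τ 0, τ 1] : Fin 3 → ℝ)) :
    normSq3 (rot3 u ![1, 0, 0] - ![1, 0, 0]) = 2 * (1 - (Real.sqrt (1 + (τ 0 ^ 2 + τ 1 ^ 2)))⁻¹) := by
  set lam := Real.sqrt (1 + (τ 0 ^ 2 + τ 1 ^ 2)) with hlam
  have hlam0 : 0 < lam := Real.sqrt_pos.2 (by positivity)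
  have hlam2 : lam ^ 2 = 1 + (τ 0 ^ 2 + τ 1 ^ 2) := Real.sq_sqrt (by positivity)
  have hvec : rot3 u ![1, 0, 0] - ![1, 0, 0] = (![lam⁻¹ - 1, lam⁻¹ * τ 0, lam⁻¹ * τ 1] : Fin 3 → ℝ) := by
    rw [hrot]; ext i; fin_cases i <;> simp
  rw [hvec]
  unfold normSq3
  rw [Fin.sum_univ_three]
  simp only [Matrix.cons_val_zero, Matrix.cons_val_one, Matrix.cons_val_two, Matrix.head_cons, Matrix.tail_cons]
  have e : (lam⁻¹ - 1) ^ 2 + (lam⁻¹ * τ 0) ^ 2 + (lam⁻¹ * τ 1) ^ 2 = lam⁻¹ ^ 2 * (1 + (τ 0 ^ 2 + τ 1 ^ 2)) - 2 * lam⁻¹ + 1 := by ring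
  rw [e, ← hlam2, inv_pow, inv_mul_cancel₀ (pow_ne_zero 2 hlam0.ne')]
  ring

/-- ★ `normSq3 (rot3 u e₀ − e₀) ≤ τ₀² + τ₁²` on the soft letter line. [folklore] -/
theorem normSq3_rot3_e0_sub_le_of_jointTilt {u : ℍ} {τ : Fin 2 → ℝ}
    (hrot : rot3 u ![1, 0, 0] = (Real.sqrt (1 + (τ 0 ^ 2 + τ 1 ^ 2)))⁻¹ • (![1, τ 0, τ 1] : Fin 3 → ℝ)) :
    normSq3 (rot3 u ![1, 0, 0] - ![1, 0, 0]) ≤ τ 0 ^ 2 + τ 1 ^ 2 := by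
  rw [normSq3_rot3_e0_sub_of_jointTilt hrot]
  exact two_mul_one_sub_inv_sqrt_le (by positivity)

/-- ★ THE TILT OF `A(θ)` ALONG THE SOFT LETTER LINE: `‖u·A(θ)·ū − A(θ)‖ ≤ |sin θ|·√(τ₀² + τ₁²)` whenever `rot3 u e₀ = (1, τ⃗)/√(1+|τ⃗|²)`. [folklore] -/
theorem norm_unit_conj_angUnit_sub_le_jointTilt {u : ℍ} (hu : ‖u‖ = 1) {τ : Fin 2 → ℝ}
    (hrot : rot3 u ![1, 0, 0] = (Real.sqrt (1 + (τ 0 ^ 2 + τ 1 ^ 2)))⁻¹ • (![1, τ 0, τ 1] : Fin 3 → ℝ)) (θ : ℝ) :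
    ‖u * angUnit θ * star u - angUnit θ‖ ≤ |Real.sin θ| * Real.sqrt (τ 0 ^ 2 + τ 1 ^ 2) := by
  rw [norm_unit_conj_angUnit_sub hu]
  exact mul_le_mul_of_nonneg_left (Real.sqrt_le_sqrt (normSq3_rot3_e0_sub_le_of_jointTilt hrot)) (abs_nonneg _)

/-- ★ THE TILT OF `hubAt δ σ` ALONG THE SOFT LETTER LINE: `‖u·hubAt δ σ·ū − hubAt δ σ‖ ≤ √σ·√(τ₀² + τ₁²)` whenever `rot3 u e₀ = (1, τ⃗)/√(1+|τ⃗|²)`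
(for the tip hub `hubAt δ 1`, `‖hubAt δ 1‖ = √(1+δ²)`, this is `sin θ_t·|τ⃗|` relative to the hub size). [folklore] -/
theorem norm_unit_conj_hubAt_sub_le_jointTilt {u : ℍ} (hu : ‖u‖ = 1) {τ : Fin 2 → ℝ}
    (hrot : rot3 u ![1, 0, 0] = (Real.sqrt (1 + (τ 0 ^ 2 + τ 1 ^ 2)))⁻¹ • (![1, τ 0, τ 1] : Fin 3 → ℝ)) (δ σ : ℝ) :
    ‖u * hubAt δ σ * star u - hubAt δ σ‖ ≤ Real.sqrt σ * Real.sqrt (τ 0 ^ 2 + τ 1 ^ 2) := by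
  rw [norm_unit_conj_hubAt_sub hu]
  exact mul_le_mul_of_nonneg_left (Real.sqrt_le_sqrt (normSq3_rot3_e0_sub_le_of_jointTilt hrot)) (Real.sqrt_nonneg _)

/-- The squared form for the tip hub: `‖u·hubAt δ σ·ū − hubAt δ σ‖² ≤ σ·(τ₀² + τ₁²)`. [folklore] -/
theorem norm_unit_conj_hubAt_sub_sq_le_jointTilt {u : ℍ} (hu : ‖u‖ = 1) {τ : Fin 2 → ℝ}
    (hrot : rot3 u ![1, 0, 0] = (Real.sqrt (1 + (τ 0 ^ 2 + τ 1 ^ 2)))⁻¹ • (![1, τ 0, τ 1] : Fin 3 → ℝ)) (δ : ℝ) {σ : ℝ} (hσ : 0 ≤ σ) :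
    ‖u * hubAt δ σ * star u - hubAt δ σ‖ ^ 2 ≤ σ * (τ 0 ^ 2 + τ 1 ^ 2) := by
  have h := norm_unit_conj_hubAt_sub_le_jointTilt hu hrot δ σ
  have h0 : 0 ≤ ‖u * hubAt δ σ * star u - hubAt δ σ‖ := norm_nonneg _
  calc ‖u * hubAt δ σ * star u - hubAt δ σ‖ ^ 2 ≤ (Real.sqrt σ * Real.sqrt (τ 0 ^ 2 + τ 1 ^ 2)) ^ 2 := pow_le_pow_left₀ h0 h 2
    _ = σ * (τ 0 ^ 2 + τ 1 ^ 2) := by rw [mul_pow, Real.sq_sqrt hσ, Real.sq_sqrt (by positivity)]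

end Summit.QuantumFields.YangMills.Theorems.SwapVirialDeficit.BlowUpRing

end
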